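import Literature.Geometry.Symplectic.TwoHandleIsotopy
import Literature.Geometry.Symplectic.AttachingFramingProofs
import Literature.Topology.FourManifolds.Diffeotopy
import Literature.Topology.FourManifolds.ClosedBallProofs
import HarnessLib

/-!
# Framings carried along a covered isotopy end at the push-forward framing

Topic `Literature/Geometry/Symplectic`; a proofs file below `TwoHandleIsotopy.lean` supplying
the framing bookkeeping (**FRM**, `framingHomotopic_mfderiv_of_diffeotopy`) of the proof of the
isotopy invariance of 2-handle attachment
(`HandleAttachingMap.isMultiAttachment_of_linkIsotopyInBoundary`; Kosinski, *Differential
Manifolds* (1993), VIII, proof of (1.2)), as assembled in `TwoHandleIsotopyReduction.lean`.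

**Statement.** If a diffeotopy `G` of the 4-manifold with boundary `W` covers an isotopy `Φ`
of knots in `∂W` (`G_t ∘ K = Φ(t)` for `t ∈ [0, 1]`) and the framing `ν` of `K = Φ(0)` is
carried along `Φ` by the framing family `νt` (`IsFramingAlong`), then the end framing `νt 1`
of `K' = Φ(1)` is homotopic through framings (`FramingHomotopic`) to the push-forward
`dG₁(ν)`.  *Proof.* The family `μ_s = d(G₁ ∘ G_s⁻¹)(νt s)`, `s ∈ [0, 1]`, consists of
framings of the fixed knot `K' = (G₁ ∘ G_s⁻¹) ∘ Φ(s)` (push-forward of a framing by a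
diffeomorphism of `W`: continuity by the tangent map, tangency to `∂W` because
diffeomorphisms preserve the boundary, transversality to the knot by the chain rule and the
injectivity of the differential), is jointly continuous (the tangent map of the jointly smooth
`(s, x) ↦ G₁ (G_s⁻¹ x)` applied to the continuous section `(s, u) ↦ ((s, Φ_s u), (0, νt s u))`
of `T(ℝ × W)`), starts at `dG₁(ν)` (`G₀ = id`) and ends at `νt 1` (`G₁ ∘ G₁⁻¹ = id`).

## Contents (all proved)

* `mfderiv_apply_zero_of_isBoundaryPoint` (and `Diffeomorph.mfderiv_apply_zero`, both in the
  namespace of this directory) — **the differential of a boundary-preserving map preserves the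
  tangent hyperplane of the boundary**: for `C¹` `F : M → M'` between manifolds
  with boundary (models `𝓡∂`), `x ∈ ∂M`, `F` mapping boundary points near `x` to boundary
  points, and `v` with `v 0 = 0`, one has `(dF_x v) 0 = 0` (in the preferred charts; the
  general form of `attachingFraming_apply_zero` of `AttachingFramingProofs.lean`);
* `knotVelocity_comp` — `(F ∘ K)˙ = dF (K̇)`; `IsKnotFraming.pushforward` — a diffeomorphism of
  `W` pushes framings of `K` to framings of `F ∘ K`;
* `framingHomotopic_mfderiv_of_diffeotopy` — **FRM**.

## References

* A. A. Kosinski, *Differential Manifolds* (1993), III (2.7)–(2.8) (the normal bundle along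
  an isotopy), VIII proof of (1.2). [Kosinski1993]
* J. M. Lee, *Introduction to Smooth Manifolds* (2013), Thm. 1.46 / Prop. 5.41 (invariance of
  the boundary, tangent space of the boundary). [LeeSmoothManifolds2013]
-/

noncomputable section

open scoped Manifold ContDiff Topology
open Set Function Filter

namespace Literature.Geometry.Symplectic

open Literature.Topology.FourManifolds

/-! ### The differential of a boundary-preserving map preserves the boundary hyperplane -/

section BoundaryTangent

variable {m m' : ℕ}
  {M : Type*} [TopologicalSpace M] [ChartedSpace (EuclideanHalfSpace (m + 1)) M]
  [IsManifold (𝓡∂ (m + 1)) ∞ M]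
  {M' : Type*} [TopologicalSpace M'] [ChartedSpace (EuclideanHalfSpace (m' + 1)) M']
  [IsManifold (𝓡∂ (m' + 1)) ∞ M']

/-- Local notation: `𝔼 n` is the model Euclidean space `EuclideanSpace ℝ (Fin n)`. -/
local notation "𝔼 " n:arg => EuclideanSpace ℝ (Fin n)

omit [IsManifold (𝓡∂ (m + 1)) ∞ M] in
/-- Directions in the hyperplane `{x₀ = 0}` lie in its tangent cone at any of its points (any
dimension; the case `m + 1 = 4` is `mem_tangentConeAt_hyperplane` of
`AttachingFramingProofs.lean`). [folklore] -/
theorem mem_tangentConeAt_hyperplane' {p w : 𝔼 (m + 1)} (hp : p 0 = 0) (hw : w 0 = 0) :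
    w ∈ tangentConeAt ℝ {q : 𝔼 (m + 1) | q 0 = 0} p := by
  have hseg : segment ℝ p (p + w) ⊆ {q : 𝔼 (m + 1) | q 0 = 0} := by
    refine (convex_iff_segment_subset.1 ?_) (by exact hp) ?_
    · intro a ha b hb s t _ _ _
      have ha0 : a 0 = 0 := ha
      have hb0 : b 0 = 0 := hb
      show (s • a + t • b) 0 = 0
      simp [ha0, hb0]
    · show (p + w) 0 = 0
      simp [hp, hw]
  have := mem_tangentConeAt_of_segment_subset hseg
  rwa [add_sub_cancel_left] at this

/-- **Boundary points have vanishing `0`-th coordinate in every chart of the atlas around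
them** (smooth invariance of the boundary, Mathlib's `isBoundaryPoint_iff_of_mem_atlas`; the
argument of `extChartAt_attachingMap_apply_zero_of_norm_eq_one`, `AttachingFramingProofs.lean`).
This and the next lemma are the `chartAt` instance of the tree's iff
`Literature.Topology.FourManifolds.extend_apply_zero_eq_zero_iff` (`SPC4MorseExistence.lean`,
maximal-atlas charts), kept as a local copy because that file is too heavy to import here; a
librarian may hoist the iff to a light file and delete both copies.
[cite: LeeSmoothManifolds2013, Thm. 1.46] -/
theorem extend_apply_zero_of_isBoundaryPoint {x₀ z : M} (hz : (𝓡∂ (m + 1)).IsBoundaryPoint z)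
    (hzs : z ∈ (chartAt (EuclideanHalfSpace (m + 1)) x₀).source) :
    (extChartAt (𝓡∂ (m + 1)) x₀ z) 0 = 0 := by
  set e := chartAt (EuclideanHalfSpace (m + 1)) x₀ with he
  rw [(𝓡∂ (m + 1)).isBoundaryPoint_iff_of_mem_atlas (n := ∞) (by simp) (chart_mem_atlas _ x₀) hzs] at hz
  have hnot : e.extend (𝓡∂ (m + 1)) z ∉ interior (e.extend (𝓡∂ (m + 1))).target := fun hi => hz.2 hi
  have hnot' : e.extend (𝓡∂ (m + 1)) z ∉ interior (range (𝓡∂ (m + 1))) := by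
    intro hi
    apply hnot
    have hyt : e z ∈ e.target := e.map_source hzs
    have := e.mem_interior_extend_target (I := 𝓡∂ (m + 1)) hyt (by
      rw [OpenPartialHomeomorph.extend_coe, comp_apply] at hi; exact hi)
    rw [OpenPartialHomeomorph.extend_coe, comp_apply]
    exact this
  rw [interior_range_modelWithCornersEuclideanHalfSpace] at hnot'
  have hge : 0 ≤ (e.extend (𝓡∂ (m + 1)) z) 0 := by
    have : e.extend (𝓡∂ (m + 1)) z ∈ range (𝓡∂ (m + 1)) := mem_range_self _
    rw [range_modelWithCornersEuclideanHalfSpace] at this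
    exact this
  simp only [mem_setOf_eq, not_lt] at hnot'
  show (e.extend (𝓡∂ (m + 1)) z) 0 = 0
  exact le_antisymm hnot' hge

/-- Conversely, **a point whose `0`-th chart coordinate vanishes is a boundary point**.
[cite: LeeSmoothManifolds2013, Thm. 1.46] -/
theorem isBoundaryPoint_of_extend_apply_zero {x₀ z : M}
    (hzs : z ∈ (chartAt (EuclideanHalfSpace (m + 1)) x₀).source)
    (hz : (extChartAt (𝓡∂ (m + 1)) x₀ z) 0 = 0) : (𝓡∂ (m + 1)).IsBoundaryPoint z := by
  set e := chartAt (EuclideanHalfSpace (m + 1)) x₀ with he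
  rw [(𝓡∂ (m + 1)).isBoundaryPoint_iff_of_mem_atlas (n := ∞) (by simp) (chart_mem_atlas _ x₀) hzs]
  refine ⟨subset_closure ((e.extend (𝓡∂ (m + 1))).map_source
    (by rwa [OpenPartialHomeomorph.extend_source])), fun hi => ?_⟩
  have hi' := e.interior_extend_target_subset_interior_range hi
  rw [interior_range_modelWithCornersEuclideanHalfSpace] at hi'
  have hz' : (e.extend (𝓡∂ (m + 1)) z) 0 = 0 := hz
  simp only [mem_setOf_eq] at hi'
  linarith

/-- **The differential of a boundary-preserving map preserves the tangent hyperplane of the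
boundary.**  Let `F : M → M'` be differentiable at the boundary point `x` of `M` (manifolds
with boundary modelled on half-spaces) and map the boundary points near `x` to boundary points
of `M'`.  Then `dF_x` (Mathlib's `mfderiv`, read in the preferred charts at `x` and `F x`) maps
the hyperplane `{v | v 0 = 0}` — the tangent space of `∂M` — into the hyperplane `{w | w 0 = 0}`:
in extended charts `F` reads `G : {x₀ ≥ 0} → {y₀ ≥ 0}` with `G({x₀ = 0}) ⊆ {y₀ = 0}` near the
base point, so the derivative within the half-space of `G₀` along the hyperplane is both
`π₀ ∘ dG` and `0` (uniqueness of derivatives on the tangent cone of the hyperplane).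
[cite: LeeSmoothManifolds2013, Prop. 5.41] -/
theorem mfderiv_apply_zero_of_isBoundaryPoint {F : M → M'} {x : M}
    (hF : MDifferentiableAt (𝓡∂ (m + 1)) (𝓡∂ (m' + 1)) F x)
    (hx : (𝓡∂ (m + 1)).IsBoundaryPoint x)
    (hmaps : ∀ᶠ y in 𝓝 x, (𝓡∂ (m + 1)).IsBoundaryPoint y → (𝓡∂ (m' + 1)).IsBoundaryPoint (F y))
    {v : 𝔼 (m + 1)} (hv : v 0 = 0) :
    mfderiv (𝓡∂ (m + 1)) (𝓡∂ (m' + 1)) F x v ∈ {w : 𝔼 (m' + 1) | w 0 = 0} := by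
  -- the written-in-charts map and its derivative within the half-space
  set G : 𝔼 (m + 1) → 𝔼 (m' + 1) := writtenInExtChartAt (𝓡∂ (m + 1)) (𝓡∂ (m' + 1)) x F with hG
  set L : 𝔼 (m + 1) →L[ℝ] 𝔼 (m' + 1) := mfderiv (𝓡∂ (m + 1)) (𝓡∂ (m' + 1)) F x with hL
  set p : 𝔼 (m + 1) := extChartAt (𝓡∂ (m + 1)) x x with hp
  have hp0 : p 0 = 0 := extend_apply_zero_of_isBoundaryPoint hx (mem_chart_source _ _)
  have hGd : HasFDerivWithinAt G L (range (𝓡∂ (m + 1))) p := hF.hasMFDerivAt.2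
  -- the `0`-th component
  set π₀ : 𝔼 (m' + 1) →L[ℝ] ℝ := EuclideanSpace.proj (0 : Fin (m' + 1)) with hπ
  have hG0d : HasFDerivWithinAt (fun q => π₀ (G q)) (π₀.comp L) (range (𝓡∂ (m + 1))) p :=
    π₀.hasFDerivAt.comp_hasFDerivWithinAt p hGd
  -- the hyperplane through `p`, inside the half-space
  set S : Set (𝔼 (m + 1)) := {q | q 0 = 0} with hS
  have hSsub : S ⊆ range (𝓡∂ (m + 1)) := fun q hq => by
    rw [range_modelWithCornersEuclideanHalfSpace]; exact le_of_eq (Eq.symm hq)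
  have hG0S : HasFDerivWithinAt (fun q => π₀ (G q)) (π₀.comp L) S p := hG0d.mono hSsub
  -- `G₀` vanishes on `S` near `p`
  have hzero : ∀ᶠ q in 𝓝[S] p, π₀ (G q) = 0 := by
    have hn1 : ∀ᶠ q in 𝓝[range (𝓡∂ (m + 1))] p, q ∈ (extChartAt (𝓡∂ (m + 1)) x).target :=
      extChartAt_target_mem_nhdsWithin x
    -- near `p`, the preimage point is close to `x`: in the `hmaps` neighbourhood and mapped by
    -- `F` into the chart at `F x`
    have hc : ContinuousWithinAt (F ∘ (extChartAt (𝓡∂ (m + 1)) x).symm) (range (𝓡∂ (m + 1))) p := by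
      refine ContinuousAt.comp_continuousWithinAt ?_ ?_
      · rw [hp, extChartAt_to_inv]; exact hF.continuousAt
      · rw [hp]; exact (continuousAt_extChartAt_symm x).continuousWithinAt
    have hc' : ContinuousWithinAt (extChartAt (𝓡∂ (m + 1)) x).symm (range (𝓡∂ (m + 1))) p := by
      rw [hp]; exact (continuousAt_extChartAt_symm x).continuousWithinAt
    have hn2 : ∀ᶠ q in 𝓝[range (𝓡∂ (m + 1))] p,
        F ((extChartAt (𝓡∂ (m + 1)) x).symm q) ∈ (chartAt (EuclideanHalfSpace (m' + 1)) (F x)).source := by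
      have ho : (chartAt (EuclideanHalfSpace (m' + 1)) (F x)).source ∈
          𝓝 ((F ∘ (extChartAt (𝓡∂ (m + 1)) x).symm) p) := by
        rw [comp_apply, hp, extChartAt_to_inv]
        exact (chartAt _ _).open_source.mem_nhds (mem_chart_source _ _)
      exact hc.preimage_mem_nhdsWithin ho
    have hn3 : ∀ᶠ q in 𝓝[range (𝓡∂ (m + 1))] p,
        (extChartAt (𝓡∂ (m + 1)) x).symm q ∈ {y | (𝓡∂ (m + 1)).IsBoundaryPoint y →
          (𝓡∂ (m' + 1)).IsBoundaryPoint (F y)} ∩ (chartAt (EuclideanHalfSpace (m + 1)) x).source := by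
      refine hc'.preimage_mem_nhdsWithin ?_
      rw [hp, extChartAt_to_inv]
      exact inter_mem hmaps ((chartAt _ _).open_source.mem_nhds (mem_chart_source _ _))
    have hn : ∀ᶠ q in 𝓝[S] p, q ∈ (extChartAt (𝓡∂ (m + 1)) x).target ∧
        F ((extChartAt (𝓡∂ (m + 1)) x).symm q) ∈ (chartAt (EuclideanHalfSpace (m' + 1)) (F x)).source ∧
        (extChartAt (𝓡∂ (m + 1)) x).symm q ∈ {y | (𝓡∂ (m + 1)).IsBoundaryPoint y →
          (𝓡∂ (m' + 1)).IsBoundaryPoint (F y)} ∩ (chartAt (EuclideanHalfSpace (m + 1)) x).source :=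
      nhdsWithin_mono p hSsub (hn1.and (hn2.and hn3))
    filter_upwards [hn, self_mem_nhdsWithin] with q hq hqS
    obtain ⟨hq1, hq2, hq3, hq4⟩ := hq
    set y : M := (extChartAt (𝓡∂ (m + 1)) x).symm q with hy
    have hqy : extChartAt (𝓡∂ (m + 1)) x y = q := (extChartAt (𝓡∂ (m + 1)) x).right_inv hq1
    have hyb : (𝓡∂ (m + 1)).IsBoundaryPoint y :=
      isBoundaryPoint_of_extend_apply_zero hq4 (by rw [hqy]; exact hqS)
    have hFyb : (𝓡∂ (m' + 1)).IsBoundaryPoint (F y) := hq3 hyb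
    have := extend_apply_zero_of_isBoundaryPoint hFyb hq2
    simp only [hG, writtenInExtChartAt, comp_apply, hπ]
    exact this
  have hG0p : π₀ (G p) = 0 := by
    have hFxb : (𝓡∂ (m' + 1)).IsBoundaryPoint (F x) := hmaps.self_of_nhds hx
    have := extend_apply_zero_of_isBoundaryPoint hFxb (mem_chart_source _ _)
    simp only [hG, writtenInExtChartAt, comp_apply, hπ, hp, extChartAt_to_inv]
    exact this
  have hZ : HasFDerivWithinAt (fun q => π₀ (G q)) (0 : 𝔼 (m + 1) →L[ℝ] ℝ) S p :=
    (hasFDerivWithinAt_const (0 : ℝ) p S).congr_of_eventuallyEq hzero hG0p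
  -- uniqueness on the tangent cone of `S` at `p`, which contains `v`
  have hcone : v ∈ tangentConeAt ℝ S p := mem_tangentConeAt_hyperplane' hp0 hv
  have huniq := hG0S.unique_on hZ hcone
  simp only [ContinuousLinearMap.comp_apply, hπ] at huniq
  exact huniq

/-- **Diffeomorphisms of manifolds with boundary have boundary-preserving differentials**:
`(dΦ_x v) 0 = 0` whenever `x ∈ ∂M` and `v 0 = 0`. [cite: LeeSmoothManifolds2013, Prop. 5.41] -/
theorem Diffeomorph.mfderiv_apply_zero (Φ : M ≃ₘ⟮𝓡∂ (m + 1), 𝓡∂ (m' + 1)⟯ M') {x : M}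
    (hx : (𝓡∂ (m + 1)).IsBoundaryPoint x) {v : 𝔼 (m + 1)} (hv : v 0 = 0) :
    mfderiv (𝓡∂ (m + 1)) (𝓡∂ (m' + 1)) Φ x v ∈ {w : 𝔼 (m' + 1) | w 0 = 0} := by
  refine mfderiv_apply_zero_of_isBoundaryPoint ((Φ.contMDiff x).mdifferentiableAt (by simp))
    hx (Eventually.of_forall fun y hy => ?_) hv
  have : Φ y ∈ Φ '' (𝓡∂ (m + 1)).boundary M := mem_image_of_mem _ hy
  rw [Diffeomorph.image_boundary (by simp) Φ] at this
  exact this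

end BoundaryTangent

/-! ### Push-forward of knot framings by diffeomorphisms -/

/-- The model vector space `ℝ⁴` of the tangent spaces. [folklore] -/
local notation "E4" => EuclideanSpace ℝ (Fin 4)

/-- Local notation: `𝕊 n` is the unit sphere in `EuclideanSpace ℝ (Fin (n + 1))`. -/
local notation "𝕊 " n:arg => (Metric.sphere (0 : EuclideanSpace ℝ (Fin (n + 1))) 1)

section Pushforward

variable {W : Type*} [TopologicalSpace W] [ChartedSpace (EuclideanHalfSpace 4) W]
  [IsManifold (𝓡∂ 4) ∞ W]

omit [IsManifold (𝓡∂ 4) ∞ W] in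
/-- **Chain rule for the knot velocity**: `(F ∘ K)˙(t) = dF (K̇(t))` for `F` differentiable
and `K` differentiable. [folklore] -/
theorem knotVelocity_comp {K : 𝕊 1 → W} {F : W → W} (hF : MDifferentiable (𝓡∂ 4) (𝓡∂ 4) F)
    (hK : MDifferentiable (𝓡 1) (𝓡∂ 4) K) (t : ℝ) :
    knotVelocity (F ∘ K) t = mfderiv (𝓡∂ 4) (𝓡∂ 4) F (K (circlePt t)) (knotVelocity K t) := by
  have hc : MDifferentiableAt 𝓘(ℝ, ℝ) (𝓡∂ 4) (K ∘ circlePt) t :=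
    (hK _).comp t (contMDiff_circlePt.mdifferentiableAt (by simp))
  unfold knotVelocity
  rw [show (F ∘ K) ∘ circlePt = F ∘ (K ∘ circlePt) from rfl, mfderiv_comp t (hF _) hc]
  rfl

/-- **Diffeomorphisms push framings forward**: if `ν` is a framing of the knot `K` in `∂W`
(`IsKnotFraming`) and `F` a diffeomorphism of `W`, then `u ↦ dF_{K u}(ν u)` is a framing of
`F ∘ K` — continuous (tangent map), tangent to `∂W` (diffeomorphisms preserve the boundary,
`Diffeomorph.mfderiv_apply_zero`), nowhere tangent to the knot (`knotVelocity_comp` and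
injectivity of `dF`). [folklore] -/
theorem IsKnotFraming.pushforward {K : 𝕊 1 → W} {ν : 𝕊 1 → E4} (hK : IsBoundaryKnot K)
    (hν : IsKnotFraming K ν) (F : W ≃ₘ⟮𝓡∂ 4, 𝓡∂ 4⟯ W) :
    IsKnotFraming (F ∘ K) fun u => mfderiv (𝓡∂ 4) (𝓡∂ 4) F (K u) (ν u) where
  continuous := by
    have h1 : Continuous (tangentMap (𝓡∂ 4) (𝓡∂ 4) F) := F.contMDiff.continuous_tangentMap (by simp)
    exact h1.comp hν.continuous
  mem_boundaryTangentSpace u :=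
    (mem_boundaryTangentSpace_iff _).2 (Diffeomorph.mfderiv_apply_zero F (hK.isBoundaryPoint u)
      ((mem_boundaryTangentSpace_iff _).1 (hν.mem_boundaryTangentSpace u)))
  not_mem_span t := by
    have hFd : MDifferentiable (𝓡∂ 4) (𝓡∂ 4) F := fun x => (F.contMDiff x).mdifferentiableAt (by simp)
    have hKd : MDifferentiable (𝓡 1) (𝓡∂ 4) K := fun u =>
      (hK.isSmoothEmbedding.contMDiff u).mdifferentiableAt (by simp)
    rw [knotVelocity_comp hFd hKd, Submodule.mem_span_singleton]
    rintro ⟨c, hc⟩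
    have hinj : Injective (mfderiv (𝓡∂ 4) (𝓡∂ 4) F (K (circlePt t))) := fun a b hab =>
      (Diffeomorph.mfderivToContinuousLinearEquiv F (by simp) (K (circlePt t))).injective hab
    exact hν.not_mem_span t (Submodule.mem_span_singleton.2
      ⟨c, hinj ((ContinuousLinearMap.map_smul _ c _).trans hc)⟩)

/-- The knot pushed forward by a diffeomorphism is a knot in the boundary. [folklore] -/
theorem IsBoundaryKnot.comp_diffeomorph {K : 𝕊 1 → W} (hK : IsBoundaryKnot K)
    (F : W ≃ₘ⟮𝓡∂ 4, 𝓡∂ 4⟯ W) : IsBoundaryKnot (F ∘ K) where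
  isSmoothEmbedding := hK.isSmoothEmbedding.diffeomorph_comp F
  isBoundaryPoint u := by
    have : F (K u) ∈ F '' (𝓡∂ 4).boundary W := mem_image_of_mem _ (hK.isBoundaryPoint u)
    rw [Diffeomorph.image_boundary (by simp) F] at this
    exact this

end Pushforward

/-! ### Proof of FRM -/

section FRM

variable {W : Type*} [TopologicalSpace W] [ChartedSpace (EuclideanHalfSpace 4) W]
  [IsManifold (𝓡∂ 4) ∞ W]

omit [IsManifold (𝓡∂ 4) ∞ W] in
/-- Points of the tangent bundle with equal base points and equal vectors are equal (the
fibres of `TW` are all the model space `E4`). [folklore] -/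
theorem tangentBundle_mk_eq {b₁ b₂ : W} (hb : b₁ = b₂) {v₁ v₂ : E4} (hv : v₁ = v₂) :
    (Bundle.TotalSpace.mk' E4 b₁ v₁ : TangentBundle (𝓡∂ 4) W) = Bundle.TotalSpace.mk' E4 b₂ v₂ := by
  subst hb; subst hv; rfl

omit [IsManifold (𝓡∂ 4) ∞ W] in
/-- **The comparison map `Ψ (s, x) = G₁ (G_s⁻¹ x)` of a diffeotopy** is jointly smooth.
[folklore] -/
theorem contMDiff_diffeotopy_comparison (G : Diffeotopy (𝓡∂ 4) W) :
    ContMDiff (𝓘(ℝ, ℝ).prod (𝓡∂ 4)) (𝓡∂ 4) ∞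
      fun p : ℝ × W => G.toFun 1 (G.invFun p.1 p.2) :=
  (G.contMDiff_toFun 1).comp G.contMDiff_uncurry_invFun

omit [IsManifold (𝓡∂ 4) ∞ W] in
/-- The partial derivative of the comparison map in the `W`-direction is the derivative of the
stage `G₁ ∘ G_s⁻¹`: `dΨ_{(s, x)}(0, v) = d(G₁ ∘ G_s⁻¹)_x v`. [folklore] -/
theorem mfderiv_diffeotopy_comparison_inr (G : Diffeotopy (𝓡∂ 4) W) (s : ℝ) (x : W) (v : E4) :
    mfderiv (𝓘(ℝ, ℝ).prod (𝓡∂ 4)) (𝓡∂ 4) (fun p : ℝ × W => G.toFun 1 (G.invFun p.1 p.2)) (s, x)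
        ((0 : ℝ), v) =
      mfderiv (𝓡∂ 4) (𝓡∂ 4) (fun z : W => G.toFun 1 (G.invFun s z)) x v := by
  have hd : MDifferentiableAt (𝓘(ℝ, ℝ).prod (𝓡∂ 4)) (𝓡∂ 4)
      (fun p : ℝ × W => G.toFun 1 (G.invFun p.1 p.2)) (s, x) :=
    (contMDiff_diffeotopy_comparison G (s, x)).mdifferentiableAt (by simp)
  rw [mfderiv_prod_eq_add_apply hd]
  have h0 : (mfderiv 𝓘(ℝ, ℝ) (𝓡∂ 4) (fun z : ℝ => G.toFun 1 (G.invFun z x)) s) (0 : ℝ) = 0 :=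
    map_zero _
  rw [h0, zero_add]

/-- **FRM — framings carried along a covered isotopy end at the push-forward framing**
(Kosinski 1993, III (2.7)–(2.8): along an isotopy the normal bundles form a bundle over
`M × ℝ`; folklore bookkeeping).  If the diffeotopy `G` of `W` covers the isotopy `Φ` of knots in
`∂W` (`G_t ∘ K = Φ(t)`, `t ∈ [0, 1]`) and the framing `ν` of `K` is carried along `Φ` to `νt 1`
(`IsFramingAlong`), then `νt 1` is homotopic, as a framing of `K' = Φ(1)`, to the push-forward
`dG₁(ν)`: the family `s ↦ d(G₁G_s⁻¹)(νt s)` joins them (see the module docstring). [folklore] -/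
theorem framingHomotopic_mfderiv_of_diffeotopy {K K' : 𝕊 1 → W}
    (Φ : KnotIsotopyInBoundary K K') (G : Diffeotopy (𝓡∂ 4) W)
    (hG : ∀ t ∈ Icc (0 : ℝ) 1, G.toFun t ∘ K = Φ.toFun t) {ν : 𝕊 1 → E4} {νt : ℝ → 𝕊 1 → E4}
    (hν : IsFramingAlong Φ ν νt) :
    FramingHomotopic K' (fun u => mfderiv (𝓡∂ 4) (𝓡∂ 4) (G.toFun 1) (K u) (ν u)) (νt 1) := by
  have hK' : IsBoundaryKnot K' := Φ.isBoundaryKnot_right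
  -- the stages `F s = G₁ ∘ G_s⁻¹` and the comparison map `Ψ`
  set F : ℝ → W ≃ₘ⟮𝓡∂ 4, 𝓡∂ 4⟯ W := fun s => (G.stage s).symm.trans (G.stage 1) with hF_def
  have hF : ∀ s x, F s x = G.toFun 1 (G.invFun s x) := fun s x => rfl
  set Ψ : ℝ × W → W := fun p => G.toFun 1 (G.invFun p.1 p.2) with hΨ_def
  -- along `[0, 1]`, `F s ∘ Φ(s) = K'`
  have hFΦ : ∀ s ∈ Icc (0 : ℝ) 1, ∀ u, F s (Φ.toFun s u) = K' u := by
    intro s hs u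
    have h1 : Φ.toFun s u = G.toFun s (K u) := (congrFun (hG s hs) u).symm
    have h2 : G.toFun 1 (K u) = K' u := by
      have := congrFun (hG 1 ⟨zero_le_one, le_rfl⟩) u
      rw [Φ.map_one] at this
      exact this
    rw [hF, h1, Diffeotopy.invFun_toFun, h2]
  -- the family of framings
  set μ : ℝ → (𝕊 1) → E4 := fun s u => mfderiv (𝓡∂ 4) (𝓡∂ 4) (F s) (Φ.toFun s u) (νt s u)
    with hμ_def
  refine ⟨hK', μ, ⟨?_, ?_, ?_⟩, ?_⟩
  · -- start: `G₀ = id`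
    funext u
    show mfderiv (𝓡∂ 4) (𝓡∂ 4) (F 0) (Φ.toFun 0 u) (νt 0 u) = _
    have h0 : (F 0 : W → W) = G.toFun 1 := by
      funext x; rw [hF, G.invFun_zero]; rfl
    rw [h0, Φ.map_zero, hν.apply_zero]
  · -- every stage is a framing of `K'`
    intro s hs
    have h := (hν.isKnotFraming s hs).pushforward (Φ.isBoundaryKnot hs) (F s)
    have heq : (⇑(F s) ∘ Φ.toFun s) = K' := funext (hFΦ s hs)
    rw [heq] at h
    exact h
  · -- joint continuity: the tangent map of `Ψ` applied to a continuous section of `T(ℝ × W)`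
    have hΨc : Continuous (tangentMap (𝓘(ℝ, ℝ).prod (𝓡∂ 4)) (𝓡∂ 4) Ψ) :=
      (contMDiff_diffeotopy_comparison G).continuous_tangentMap (by simp)
    -- the section `(s, u) ↦ ((s, Φ_s u), (0, νt s u))`
    set σ : ℝ × (𝕊 1) → TangentBundle (𝓘(ℝ, ℝ).prod (𝓡∂ 4)) (ℝ × W) := fun p =>
      (equivTangentBundleProd 𝓘(ℝ, ℝ) ℝ (𝓡∂ 4) W).symm
        (Bundle.zeroSection ℝ (TangentSpace 𝓘(ℝ, ℝ) : ℝ → Type) p.1,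
          (Bundle.TotalSpace.mk' E4 (Φ.toFun p.1 p.2) (νt p.1 p.2) : TangentBundle (𝓡∂ 4) W))
      with hσ_def
    have hσc : ContinuousOn σ (Icc (0 : ℝ) 1 ×ˢ univ) := by
      have he : Continuous (equivTangentBundleProd 𝓘(ℝ, ℝ) ℝ (𝓡∂ 4) W).symm :=
        (contMDiff_equivTangentBundleProd_symm (n := ∞)).continuous
      refine he.comp_continuousOn (ContinuousOn.prodMk ?_ hν.continuousOn)
      exact ((Bundle.Trivialization.continuous_zeroSection ℝ (F := ℝ)
        (E := (TangentSpace 𝓘(ℝ, ℝ) : ℝ → Type))).comp continuous_fst).continuousOn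
    refine (hΨc.comp_continuousOn hσc).congr fun p hp => ?_
    -- pointwise: `tangentMap Ψ (σ p) = (K' u, μ s u)`
    obtain ⟨hp1, -⟩ := hp
    show (Bundle.TotalSpace.mk' E4 (K' p.2) (μ p.1 p.2) : TangentBundle (𝓡∂ 4) W) =
      tangentMap (𝓘(ℝ, ℝ).prod (𝓡∂ 4)) (𝓡∂ 4) Ψ (σ p)
    have hσp : σ p = ⟨(p.1, Φ.toFun p.1 p.2), ((0 : ℝ), νt p.1 p.2)⟩ := rfl
    rw [hσp, tangentMap]
    refine tangentBundle_mk_eq (hFΦ p.1 hp1 p.2).symm ?_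
    show μ p.1 p.2 = mfderiv (𝓘(ℝ, ℝ).prod (𝓡∂ 4)) (𝓡∂ 4) Ψ (p.1, Φ.toFun p.1 p.2)
      ((0 : ℝ), νt p.1 p.2)
    rw [hΨ_def, mfderiv_diffeotopy_comparison_inr]
    rfl
  · -- end: `G₁ ∘ G₁⁻¹ = id`
    funext u
    show mfderiv (𝓡∂ 4) (𝓡∂ 4) (F 1) (Φ.toFun 1 u) (νt 1 u) = νt 1 u
    have h1 : (F 1 : W → W) = id := by
      funext x; rw [hF]; exact G.toFun_invFun 1 x
    rw [h1, mfderiv_id]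
    rfl

end FRM

end Literature.Geometry.Symplectic

end
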